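import Literature.NumberTheory.Transcendental.NesterenkoEliminationCor410Proofs
import Literature.NumberTheory.Transcendental.NesterenkoEliminationCor412Proofs
import Literature.NumberTheory.Transcendental.NesterenkoEliminationProp47ValuesProofs
import Mathlib.Analysis.Normed.Group.Ultra
import Mathlib.Data.Finsupp.MonomialOrder
import Mathlib.RingTheory.MvPolynomial.MonomialOrder
import HarnessLib

/-!
# Gauss's lemma for the maximum-of-coefficients norm over an ultrametric field — proofs only

`Literature/NumberTheory/Transcendental/NesterenkoMaxNormUltrametric.lean`. For the norm
`|P| = max_γ |a_γ|` of Definition 4.1 of Nesterenko–Philippon (eds.), LNM 1752, Ch. 3 §4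
(`Nesterenko.maxNorm`, any normed field of coefficients) we prove that over a field `L` whose norm
is NON-ARCHIMEDEAN (`IsUltrametricDist L`) it is multiplicative on multivariate polynomials in
finitely many variables:

* `Nesterenko.maxNorm_mul_le_of_isUltrametricDist` — `|PQ| ≤ |P| |Q|` (any set of variables);
* `Nesterenko.maxNorm_mul_of_monomialOrder` — `|PQ| = |P| |Q|` given a monomial order on the
  variables; `Nesterenko.maxNorm_mul` — the same for any `Finite` set of variables (transport to
  `Fin n`); `maxNorm_pow`, `maxNorm_prod`.

This is the classical Gauss lemma (the Gauss norm is an absolute value; Mathlib has the one-variable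
case `Polynomial.gaussNorm_mul`): choose, for a monomial order, the LARGEST exponents `α₀`, `β₀`
among those where `|P|`, resp. `|Q|`, is attained; in the coefficient of `x^{α₀+β₀}` in `PQ` the term
`a_{α₀} b_{β₀}` strictly dominates every other term `a_α b_β` (`α + β = α₀ + β₀`, `α ≠ α₀`: either
`|a_α| < |P|`, or `α ≺ α₀` and then `β ≻ β₀` so `|b_β| < |Q|`), hence by the ultrametric
inequality that coefficient has norm exactly `|P| |Q|`. It is the reason why "if `𝓜_∞ = ∅` then
equality holds" in Prop. 4.7 2)–3) of Ch. 3 (p. 39) and why all error terms of Ch. 3 §4 "can be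
omitted" over `ℂ(z)` in Ch. 10 (p. 153).

## References

* [NesterenkoPhilippon2001] Yu. V. Nesterenko, P. Philippon (eds.), *Introduction to Algebraic
  Independence Theory*, LNM 1752, Springer 2001, Ch. 3 §4 Def. 4.1 (p. 37), Prop. 4.7 and the
  sentence after it (p. 39); Ch. 10 §2 (p. 153).
* N. Bourbaki, *Commutative Algebra*, Ch. VI §10 no. 1, Prop. 2 (Gauss's lemma for valuations).
-/

noncomputable section

open MvPolynomial

namespace Literature.NumberTheory.Transcendental

namespace Nesterenko

variable {L : Type*} [NormedField L] {σ : Type*}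

/-- `|PQ| ≤ |P| · |Q|` over a non-archimedean normed field (every coefficient of `PQ` is a sum of
products `a_α b_β`, each of norm `≤ |P| |Q|`). [folklore] -/
theorem maxNorm_mul_le_of_isUltrametricDist [IsUltrametricDist L] (P Q : MvPolynomial σ L) :
    maxNorm (P * Q) ≤ maxNorm P * maxNorm Q := by
  classical
  refine maxNorm_le_of_forall_le (mul_nonneg (maxNorm_nonneg P) (maxNorm_nonneg Q)) fun γ _ => ?_
  rw [coeff_mul]
  refine IsUltrametricDist.norm_sum_le_of_forall_le_of_nonneg
    (mul_nonneg (maxNorm_nonneg P) (maxNorm_nonneg Q)) fun x _ => ?_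
  rw [norm_mul]
  exact mul_le_mul (norm_coeff_le_maxNorm P x.1) (norm_coeff_le_maxNorm Q x.2) (norm_nonneg _)
    (maxNorm_nonneg P)

/-- **Gauss's lemma, core**: with a monomial order on the exponents, `|PQ| = |P| |Q|` over a
non-archimedean normed field. [folklore] -/
theorem maxNorm_mul_of_monomialOrder [IsUltrametricDist L] (mo : MonomialOrder σ)
    (P Q : MvPolynomial σ L) : maxNorm (P * Q) = maxNorm P * maxNorm Q := by
  classical
  rcases eq_or_ne P 0 with rfl | hP
  · simp
  rcases eq_or_ne Q 0 with rfl | hQ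
  · simp
  refine le_antisymm (maxNorm_mul_le_of_isUltrametricDist P Q) ?_
  -- the exponents where `|P|`, `|Q|` are attained, and the largest ones for `mo`
  set SP : Finset (σ →₀ ℕ) := P.support.filter fun α => ‖coeff α P‖ = maxNorm P with hSP
  set SQ : Finset (σ →₀ ℕ) := Q.support.filter fun β => ‖coeff β Q‖ = maxNorm Q with hSQ
  have hSPne : SP.Nonempty := by
    obtain ⟨α, hα, h⟩ := exists_norm_coeff_eq_maxNorm hP
    exact ⟨α, Finset.mem_filter.mpr ⟨hα, h⟩⟩
  have hSQne : SQ.Nonempty := by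
    obtain ⟨β, hβ, h⟩ := exists_norm_coeff_eq_maxNorm hQ
    exact ⟨β, Finset.mem_filter.mpr ⟨hβ, h⟩⟩
  obtain ⟨α₀, hα₀, hα₀max⟩ := Finset.exists_max_image SP (fun α => mo.toSyn α) hSPne
  obtain ⟨β₀, hβ₀, hβ₀max⟩ := Finset.exists_max_image SQ (fun β => mo.toSyn β) hSQne
  have hPα₀ : ‖coeff α₀ P‖ = maxNorm P := (Finset.mem_filter.mp hα₀).2
  have hQβ₀ : ‖coeff β₀ Q‖ = maxNorm Q := (Finset.mem_filter.mp hβ₀).2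
  have hMP : 0 < maxNorm P := maxNorm_pos hP
  have hMQ : 0 < maxNorm Q := maxNorm_pos hQ
  -- every other term of the coefficient of `x^{α₀+β₀}` is strictly smaller
  have hdom : ∀ x ∈ Finset.antidiagonal (α₀ + β₀), x ≠ (α₀, β₀) →
      ‖coeff x.1 P * coeff x.2 Q‖ < ‖coeff α₀ P * coeff β₀ Q‖ := by
    rintro ⟨α, β⟩ hx hne
    rw [Finset.mem_antidiagonal] at hx
    rw [norm_mul, norm_mul, hPα₀, hQβ₀]
    have hαle : ‖coeff α P‖ ≤ maxNorm P := norm_coeff_le_maxNorm P α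
    have hβle : ‖coeff β Q‖ ≤ maxNorm Q := norm_coeff_le_maxNorm Q β
    rcases hαle.lt_or_eq with hαlt | hαeq
    · calc ‖coeff α P‖ * ‖coeff β Q‖ ≤ ‖coeff α P‖ * maxNorm Q :=
            mul_le_mul_of_nonneg_left hβle (norm_nonneg _)
        _ < maxNorm P * maxNorm Q := mul_lt_mul_of_pos_right hαlt hMQ
    · -- `|a_α| = |P|`: then `α ≺ α₀`, so `β ≻ β₀` and `|b_β| < |Q|`
      have hαsupp : α ∈ P.support := by
        rw [mem_support_iff]
        intro h0
        rw [h0, norm_zero] at hαeq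
        exact hMP.ne' hαeq.symm
      have hαS : α ∈ SP := Finset.mem_filter.mpr ⟨hαsupp, hαeq⟩
      have hαne : α ≠ α₀ := by
        intro h
        apply hne
        subst h
        have hβ : β = β₀ := add_left_cancel hx
        rw [hβ]
      have hαlt : mo.toSyn α < mo.toSyn α₀ :=
        lt_of_le_of_ne (hα₀max α hαS) fun h => hαne (mo.toSyn.injective h)
      have hsum : mo.toSyn α + mo.toSyn β = mo.toSyn α₀ + mo.toSyn β₀ := by
        rw [← map_add, ← map_add, hx]
      have hβgt : mo.toSyn β₀ < mo.toSyn β := by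
        by_contra hle
        push Not at hle
        have := add_lt_add_of_lt_of_le hαlt hle
        rw [hsum] at this
        exact lt_irrefl _ this
      have hβlt : ‖coeff β Q‖ < maxNorm Q := by
        refine hβle.lt_of_ne fun hβeq => ?_
        have hβsupp : β ∈ Q.support := by
          rw [mem_support_iff]
          intro h0
          rw [h0, norm_zero] at hβeq
          exact hMQ.ne' hβeq.symm
        have hβS : β ∈ SQ := Finset.mem_filter.mpr ⟨hβsupp, hβeq⟩
        exact absurd (hβ₀max β hβS) (not_le.mpr hβgt)
      calc ‖coeff α P‖ * ‖coeff β Q‖ ≤ maxNorm P * ‖coeff β Q‖ :=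
            mul_le_mul_of_nonneg_right hαle (norm_nonneg _)
        _ < maxNorm P * maxNorm Q := mul_lt_mul_of_pos_left hβlt hMP
  -- hence that coefficient has norm exactly `|P| |Q|`
  have hk : ((α₀, β₀) : (σ →₀ ℕ) × (σ →₀ ℕ)) ∈ Finset.antidiagonal (α₀ + β₀) :=
    Finset.mem_antidiagonal.mpr rfl
  have key := IsNonarchimedean.apply_sum_eq_of_lt (f := (norm : L → ℝ))
    (l := fun x : (σ →₀ ℕ) × (σ →₀ ℕ) => coeff x.1 P * coeff x.2 Q)
    IsUltrametricDist.isNonarchimedean_norm (fun a => (norm_neg a).symm) hk hdom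
  have hcoeff : ‖coeff (α₀ + β₀) (P * Q)‖ = maxNorm P * maxNorm Q := by
    rw [coeff_mul]
    refine key.trans ?_
    rw [norm_mul, hPα₀, hQβ₀]
  rw [← hcoeff]
  exact norm_coeff_le_maxNorm _ _

/-- `|1| = 1` (non-trivial coefficients). [folklore] -/
private theorem maxNorm_one_eq : maxNorm (1 : MvPolynomial σ L) = 1 := by
  classical
  obtain ⟨e, he, h⟩ := exists_norm_coeff_eq_maxNorm (one_ne_zero : (1 : MvPolynomial σ L) ≠ 0)
  rw [← h]
  have he0 : e = 0 := by
    have : e ∈ ({0} : Finset (σ →₀ ℕ)) := by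
      have hsub : (1 : MvPolynomial σ L).support ⊆ {0} := by
        rw [show (1 : MvPolynomial σ L) = monomial 0 1 from rfl]
        exact support_monomial_subset
      exact hsub he
    simpa using this
  subst he0
  simp

/-- **Gauss's lemma for `|·|`**: over a non-archimedean normed field, the maximum of the norms of
the coefficients is multiplicative on polynomials in finitely many variables, `|PQ| = |P| |Q|`.
[folklore] -/
theorem maxNorm_mul [IsUltrametricDist L] [Finite σ] (P Q : MvPolynomial σ L) :
    maxNorm (P * Q) = maxNorm P * maxNorm Q := by
  classical
  obtain ⟨n, ⟨e⟩⟩ := Finite.exists_equiv_fin σ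
  have h := maxNorm_mul_of_monomialOrder MonomialOrder.lex (rename e P) (rename e Q)
  rwa [← map_mul, maxNorm_rename_of_injective e.injective,
    maxNorm_rename_of_injective e.injective, maxNorm_rename_of_injective e.injective] at h

/-- `|Pⁿ| = |P|ⁿ` over a non-archimedean normed field. [folklore] -/
theorem maxNorm_pow [IsUltrametricDist L] [Finite σ] (P : MvPolynomial σ L) (n : ℕ) :
    maxNorm (P ^ n) = maxNorm P ^ n := by
  induction n with
  | zero =>
    rw [pow_zero, pow_zero]
    exact maxNorm_one_eq
  | succ n ih => rw [pow_succ, maxNorm_mul, ih, pow_succ]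

/-- `|∏ Pᵢ| = ∏ |Pᵢ|` over a non-archimedean normed field. [folklore] -/
theorem maxNorm_prod [IsUltrametricDist L] [Finite σ] {ι : Type*} (s : Finset ι)
    (P : ι → MvPolynomial σ L) : maxNorm (∏ i ∈ s, P i) = ∏ i ∈ s, maxNorm (P i) := by
  classical
  induction s using Finset.induction_on with
  | empty =>
    rw [Finset.prod_empty, Finset.prod_empty, maxNorm_one_eq]
  | insert i s hi ih => rw [Finset.prod_insert hi, Finset.prod_insert hi, maxNorm_mul, ih]

end Nesterenko

end Literature.NumberTheory.Transcendental

end
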